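import Summits.AtomisticToContinuum.HydrodynamicLimit.Theses.JParityClosure
import Summits.AtomisticToContinuum.HydrodynamicLimit.Theorems.JParityClosureRateFloorEntropyTransfer
import Summits.AtomisticToContinuum.HydrodynamicLimit.Theorems.RateFloor.Negative.WithoutEtaPos
import Summits.AtomisticToContinuum.HydrodynamicLimit.Theorems.RateFloor.Negative.RAfterN
import Literature.Analysis.FluidPDE.HardSphereCollisionRecord
import HarnessLib

/-!
# Line `hydro-immune-entropy-transfer` for crux `JParityClosure.RateFloor` (stmt-AtomisticToContinuum-13080) — CHECKED SKELETON

crux-plan seat `planner-cruxplan-stmt-AtomisticToContinuum-13080-hydro-immune-entropy-0`, 2026-08-16 (round 1; idea card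
`Cruxes/RateFloor/Ideas/hydro-immune-entropy-transfer.md`, triage TRIAGE-r1-{1,2,3}: fail / pass / pass — deciding vote pass + merge
with `cut-deficit-residence-pricing`; line card `Lines/hydro-immune-entropy-transfer.md`).

THE LINE.  The idea's lever is the one bridge from EQUILIBRIUM to non-equilibrium laws that needs no ergodicity: the entropy
inequality for events `P(E) ≤ (log 2 + KL(P‖G))/log(1/G(E))` (Kipnis–Landim App. 1 Prop. 8.2; tree
`RateFloorEntropyTransfer.measure_le_of_klDiv_le_hull`) with the pinned budget `KL(localGibbs ‖ G_N) ≤ A(profiles,σ)(N+1)` (tree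
`exists_localGibbsLaw_dominated`, `G_N = localGibbsLaw σ 1 0 1`).  It turns ONE super-exponential large-deviation UPPER bound for the
LOWER tail of the (nonnegative, additive) collision functional of the EQUILIBRIUM hard-sphere gas into the floor along every
local-Gibbs flow.  The triage panel fixed the two defects of the typed instance: the equilibrium bound must be taken (i) at the KINETIC
mollification scale `R_N = λ(N+1)^{-1/3}`, `λ ≥ λ₀` (r-scale laminar shear is an extensive-cost persistent deficit: c4's
`ShearDeficitPersistence → ¬EntropyClassRateFloor`, static half landed p126421 — the card's own BN1), and (ii) for the density-CUT
functional, cutoff `g(σ³ρ_{R_N})` on BOTH sides as in items 13078/13079 (a co-oriented dense FCC pocket met by a cone-avoiding mark is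
an extensive-cost witness against every UNCUT equilibrium bound: TRIAGE r1-1 W1 = r1-2 S1 = r1-3 N1).  So the line is

  `stub_eqSuperExpDeficitCut` (S1, THE BET: cut kinetic-scale equilibrium lower tail, rate `→ ∞`; honest target `≍ log N`, r1-3 N2)
    ⟹ `CutRateFloorKinetic` (PROVED here: `cutRateFloorKinetic_of_eqSuperExpDeficitCut`, the KL bridge)
  `CutRateFloorKinetic ∧ stub_denseRemainderFloor` (S2, the dense complement the filed UNCUT crux owes, ∀η at fixed σ)
    ⟹ `RateFloorKinetic` (PROVED here: `rateFloorKinetic_of_cut_of_dense`, additive split + union bound off the flow's null bad set)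
  `RateFloorKinetic ∧ stub_subgridDomination` (S3, the r-step the filed r-SCALE crux owes, ∀τ)
    ⟹ `RateFloor` (PROVED by lead c4, `Lines/SketchSplit.rateFloor_of_kinetic_of_subgrid`; copied into §A below verbatim —
      the check farm does not build crux workfiles as importable modules).

`RateFloor_of : S1 → S2 → S3 → JParityClosure.RateFloor` is kernel-checked; sorries live only in the three `stub_*`.
S2 and S3 are the crux's RESTATEMENT DEBT shared by every surviving line (TRIAGE r1-2 (R), r1-3 "shape of what survives"): under the
planner's conforming restatement (a) = `RateFloorKinetic` only S1+S2 remain, under (a)+cut only S1.  They are registered because this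
skeleton must conclude the filed decl by name.

DISPROOF USED (`Cruxes/RateFloor/Disproof.lean` v6; Negative lemmas imported above as the scratch check): `rateFloor_false_without_etaPos`
— `0 < η` is used at S1 (the deficit event is `< g₁σ³∫χ g B − η`), at S2 and in both unions (`η/2 + η/2`); `rateFloorRAfterN_holds` —
the order "scale before N" is used essentially: every stub mollifies at `R_N = λ(N+1)^{-1/3}` with `λ ≥ λ₀` chosen BEFORE `N`, and
`λ₀ ≥` (anything) `× σ` keeps `R_N/ε_N = λ/σ ≫ 2` away from the junk instance `2r < ε_N` (a proof of S1 valid for `λ < σ/2` would prove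
the empty-event triviality and must be rejected by the same test); §1 conventions (`pv_eq_precollisional`, hemisphere) and §2
`Kc_nonneg`/`event_empty_of_rhs_le` are inherited verbatim (S1/S2 copy the crux's `Kc`, `pv`, kernel; the lower tail of a NONNEGATIVE
functional is the one-sided, order-requiring event); c4's records GAfterR (p125525) / GAfterEta (p126309): `∃ g` precedes `∀ η` and the
scale in every stub.  No stub is an instance of a landed Negative lemma (both Negatives are about deleted `0 < η` / swapped `r`-after-`N`).
-/

noncomputable section

open scoped BigOperators Topology ENNReal NNReal InnerProductSpace RealInnerProductSpace Classical
open MeasureTheory Set Filter Function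
open Literature.Analysis.FluidPDE Literature.MathematicalPhysics.KineticTheory
open Summit.AtomisticToContinuum.HydrodynamicLimit.Theses.JParityClosure

namespace Summit.AtomisticToContinuum.HydrodynamicLimit.Cruxes.RateFloor.HydroImmuneEntropyTransfer

/-! ## §A Lead c4's split `RateFloor ⇐ RateFloorKinetic ∧ SubgridDomination` — adapted from `Cruxes/RateFloor/Lines/SketchSplit.lean`
(prover-line-stmt-AtomisticToContinuum-13080-c4-0, 2026-08-16), VERBATIM (defs + the proved composition), so that this skeleton is
self-contained: the check farm does not build crux workfiles as importable modules. -/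

-- adapted from Cruxes/RateFloor/Lines/SketchSplit.lean (c4): begin verbatim copy
/-- **`RateFloorKinetic`** (restatement (a), verbatim the skeleton's §7⅞ text): the crux mollified at the kinetic scale
`R_N = λ(N+1)^{-1/3}`. [folklore] -/
def RateFloorKinetic : Prop :=
  ∃ g₀ : ℝ, 0 < g₀ ∧ ∀ (a₀ θ₀ : Literature.MathematicalPhysics.KineticTheory.T3 → ℝ) (u₀ : Literature.MathematicalPhysics.KineticTheory.T3 → Literature.MathematicalPhysics.KineticTheory.V3), Continuous a₀ → Continuous θ₀ → Continuous u₀ → (∀ x, 0 < a₀ x) → (∀ x, 0 < θ₀ x) → ∃ σ₀ : ℝ, 0 < σ₀ ∧ ∀ σ : ℝ, 0 < σ → σ < σ₀ → ∀ Φ : (N : ℕ) → Literature.Analysis.FluidPDE.HardSphereFlow (Literature.Analysis.FluidPDE.Torus.geometry (Fin 3)) (Literature.MathematicalPhysics.KineticTheory.hsDiameter σ N) (N + 1), ∀ τ : ℝ, 0 < τ → ∀ χ : ℝ × UnitAddTorus (Fin 3) → ℝ, Continuous χ → (∀ p, 0 ≤ χ p) → ∀ Ξ : EuclideanSpace ℝ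 (Fin 3) × EuclideanSpace ℝ (Fin 3) × EuclideanSpace ℝ (Fin 3) → ℝ, Continuous Ξ → (∀ q, 0 ≤ Ξ q) → (∃ C : ℝ, ∀ q, Ξ q ≤ C) → ∀ η δ : ℝ, 0 < η → 0 < δ → ∃ lam₀ : ℝ, 0 < lam₀ ∧ ∀ lam : ℝ, lam₀ ≤ lam → ∃ N₀ : ℕ, ∀ N : ℕ, N₀ ≤ N → let r : ℝ := lam * ((N + 1 : ℕ) : ℝ) ^ (-(1 / 3 : ℝ)); let ε := Literature.MathematicalPhysics.KineticTheory.hsDiameter σ N; let G := Literature.Analysis.FluidPDE.Torus.geometry (Fin 3); let γ := fun z (s : ℝ) => (Φ N).flow s z; let bx : UnitAddTorus (Fin 3) → UnitAddTorus (Fin 3) → ℝ := fun x y => 3 / (Real.pi * r ^ 3) * max (1 - Literature.Analysis.FluidPDE.Torus.euclidDist x y / r) 0; let Θ := fun (Ξ : EuclideanSpace ℝ (Fin 3) × EuclideanSpace ℝ (Fin 3) × EuclideanSpace ℝ (Fin 3) → ℝ) (v w : EuclideanSpace ℝ (Fin 3)) => ∫ ω : Metric.sphere (0 : EuclideanSpace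 ℝ (Fin 3)) 1, Ξ ((ω : EuclideanSpace ℝ (Fin 3)), v, w) * Literature.MathematicalPhysics.KineticTheory.hardSphereKernel (w, v) ω ∂Literature.MathematicalPhysics.KineticTheory.sphereMeasure; let B := fun Ξ z s (x₀ : UnitAddTorus (Fin 3)) => ∫ p, bx p.1.1 x₀ * bx p.2.1 x₀ * Θ Ξ p.1.2 p.2.2 ∂((Literature.Analysis.FluidPDE.empiricalMeasure (γ z s)).prod (Literature.Analysis.FluidPDE.empiricalMeasure (γ z s))); let pv := fun z s (i j : Fin (N + 1)) => Literature.Analysis.FluidPDE.reflectVel (G.sepVec (γ z s i).1 (γ z s j).1) ((γ z s i).2, (γ z s j).2); let Kc := fun (Fn : Literature.Analysis.FluidPDE.Config (N + 1) (Fin 3) Literature.MathematicalPhysics.KineticTheory.T3 → ℝ → Fin (N + 1) → Fin (N + 1) → ℝ) z => ε / (N + 1 : ℝ) * ∑ᶠ (s : ℝ) (_ : s ∈ Literature.Analysis.FluidPDE.collisionTimes G ε (γ z) ∩ Set.Icc 0 τ), ∑ i : Fin (N + 1), ∑ j : Fin (N + 1), (if i ≠ j ∧ ‖G.sepVec (γ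 z s i).1 (γ z s j).1‖ = ε then Fn z s i j else 0); Literature.MathematicalPhysics.KineticTheory.localGibbsLaw σ a₀ u₀ θ₀ N (Φ N) {z | Kc (fun z s i j => χ (s, (γ z s i).1) * Ξ (ε⁻¹ • G.sepVec (γ z s i).1 (γ z s j).1, (pv z s i j).1, (pv z s i j).2)) z < g₀ * σ ^ 3 * (∫ s in Set.Icc (0 : ℝ) τ, ∫ x : UnitAddTorus (Fin 3), χ (s, x) * B Ξ z s x) - η} ≤ ENNReal.ofReal δ

/-- **`SubgridDomination`** — the isolated sub-`r` content of the filed crux: for a universal `Cd > 0`, along the local-Gibbs hard-sphere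
flow, the `r`-mollified ideal pair functional is dominated in probability by `Cd ×` the kinetic-scale one plus `η`
(`bxk`, `Bk` = the crux's `bx`, `B` at scale `λ(N+1)^{-1/3}`).  Heuristically TRUE from smooth data (energy at scale `r` is
`≍ (ε_d r)^{2/3} → 0`; density-wise the finer mollification can only increase the functional), FALSE for entropy-class data (r-scale laminar
shear), beyond entropy/energy/stationarity methods. [folklore] -/
def SubgridDomination : Prop :=
  ∃ Cd : ℝ, 0 < Cd ∧ ∀ (a₀ θ₀ : Literature.MathematicalPhysics.KineticTheory.T3 → ℝ) (u₀ : Literature.MathematicalPhysics.KineticTheory.T3 → Literature.MathematicalPhysics.KineticTheory.V3), Continuous a₀ → Continuous θ₀ → Continuous u₀ → (∀ x, 0 < a₀ x) → (∀ x, 0 < θ₀ x) → ∃ σ₀ : ℝ, 0 < σ₀ ∧ ∀ σ : ℝ, 0 < σ → σ < σ₀ → ∀ Φ : (N : ℕ) → Literature.Analysis.FluidPDE.HardSphereFlow (Literature.Analysis.FluidPDE.Torus.geometry (Fin 3)) (Literature.MathematicalPhysics.KineticTheory.hsDiameter σ N) (N + 1), ∀ τ : ℝ, 0 < τ → ∀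 χ : ℝ × UnitAddTorus (Fin 3) → ℝ, Continuous χ → (∀ p, 0 ≤ χ p) → ∀ Ξ : EuclideanSpace ℝ (Fin 3) × EuclideanSpace ℝ (Fin 3) × EuclideanSpace ℝ (Fin 3) → ℝ, Continuous Ξ → (∀ q, 0 ≤ Ξ q) → (∃ C : ℝ, ∀ q, Ξ q ≤ C) → ∀ η δ : ℝ, 0 < η → 0 < δ → ∃ r₀ : ℝ, 0 < r₀ ∧ ∀ r : ℝ, 0 < r → r < r₀ → ∃ lam₀ : ℝ, 0 < lam₀ ∧ ∀ lam : ℝ, lam₀ ≤ lam → ∃ N₀ : ℕ, ∀ N : ℕ, N₀ ≤ N → let γ := fun z (s : ℝ) => (Φ N).flow s z; let bx : UnitAddTorus (Fin 3) → UnitAddTorus (Fin 3) → ℝ := fun x y => 3 / (Real.pi * r ^ 3) * max (1 - Literature.Analysis.FluidPDE.Torus.euclidDist x y / r) 0; let bxk : UnitAddTorus (Fin 3) → UnitAddTorus (Fin 3) → ℝ := fun x y => 3 / (Real.pi * (lam * ((N + 1 : ℕ) : ℝ) ^ (-(1 / 3 : ℝ))) ^ 3) * max (1 - Literature.Analysis.FluidPDE.Torus.euclidDist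 x y / (lam * ((N + 1 : ℕ) : ℝ) ^ (-(1 / 3 : ℝ)))) 0; let Θ := fun (Ξ : EuclideanSpace ℝ (Fin 3) × EuclideanSpace ℝ (Fin 3) × EuclideanSpace ℝ (Fin 3) → ℝ) (v w : EuclideanSpace ℝ (Fin 3)) => ∫ ω : Metric.sphere (0 : EuclideanSpace ℝ (Fin 3)) 1, Ξ ((ω : EuclideanSpace ℝ (Fin 3)), v, w) * Literature.MathematicalPhysics.KineticTheory.hardSphereKernel (w, v) ω ∂Literature.MathematicalPhysics.KineticTheory.sphereMeasure; let B := fun Ξ z s (x₀ : UnitAddTorus (Fin 3)) => ∫ p, bx p.1.1 x₀ * bx p.2.1 x₀ * Θ Ξ p.1.2 p.2.2 ∂((Literature.Analysis.FluidPDE.empiricalMeasure (γ z s)).prod (Literature.Analysis.FluidPDE.empiricalMeasure (γ z s))); let Bk := fun Ξ z s (x₀ : UnitAddTorus (Fin 3)) => ∫ p, bxk p.1.1 x₀ * bxk p.2.1 x₀ * Θ Ξ p.1.2 p.2.2 ∂((Literature.Analysis.FluidPDE.empiricalMeasure (γ z s)).prod (Literature.Analysis.FluidPDE.empiricalMeasure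 (γ z s))); Literature.MathematicalPhysics.KineticTheory.localGibbsLaw σ a₀ u₀ θ₀ N (Φ N) {z | Cd * (∫ s in Set.Icc (0 : ℝ) τ, ∫ x : UnitAddTorus (Fin 3), χ (s, x) * Bk Ξ z s x) + η < (∫ s in Set.Icc (0 : ℝ) τ, ∫ x : UnitAddTorus (Fin 3), χ (s, x) * B Ξ z s x)} ≤ ENNReal.ofReal δ

/-- The union-bound arithmetic of the split, abstractly: if the kinetic deficit `K < gᵏ s Iᵏ − η₁` and the domination failure
`Cd Iᵏ + η₂ < I` are both rare, so is the macroscopic deficit `K < (gᵏ/Cd) s I − η` once `η₁ + (gᵏ/Cd) s η₂ ≤ η`. [folklore] -/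
theorem measure_deficit_le_add {α : Type*} [MeasurableSpace α] (μ : Measure α) (Kf Ir Ik : α → ℝ)
    {gk Cd s η η₁ η₂ : ℝ} (hgk : 0 ≤ gk) (hCd : 0 < Cd) (hs : 0 ≤ s) (hη : η₁ + gk / Cd * s * η₂ ≤ η) {a b : ℝ≥0∞}
    (h1 : μ {z | Kf z < gk * s * Ik z - η₁} ≤ a) (h2 : μ {z | Cd * Ik z + η₂ < Ir z} ≤ b) :
    μ {z | Kf z < gk / Cd * s * Ir z - η} ≤ a + b := by
  have hsub : {z | Kf z < gk / Cd * s * Ir z - η} ⊆ {z | Kf z < gk * s * Ik z - η₁} ∪ {z | Cd * Ik z + η₂ < Ir z} := by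
    intro z hz
    by_contra hcon
    simp only [Set.mem_union, Set.mem_setOf_eq, not_or, not_lt] at hcon
    obtain ⟨hK, hI⟩ := hcon
    have hz' : Kf z < gk / Cd * s * Ir z - η := hz
    have hc : 0 ≤ gk / Cd * s := by positivity
    have h3 : gk / Cd * s * Ir z ≤ gk / Cd * s * (Cd * Ik z + η₂) := mul_le_mul_of_nonneg_left hI hc
    have h4 : gk / Cd * s * (Cd * Ik z + η₂) = gk * s * Ik z + gk / Cd * s * η₂ := by
      field_simp
    nlinarith
  calc μ {z | Kf z < gk / Cd * s * Ir z - η} ≤ μ ({z | Kf z < gk * s * Ik z - η₁} ∪ {z | Cd * Ik z + η₂ < Ir z}) :=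
        measure_mono hsub
    _ ≤ μ {z | Kf z < gk * s * Ik z - η₁} + μ {z | Cd * Ik z + η₂ < Ir z} := measure_union_le _ _
    _ ≤ a + b := add_le_add h1 h2

/-- **THE SPLIT: `RateFloorKinetic → SubgridDomination → RateFloor`** (PROVED).  With `g₀ := g₀ᵏ/Cd`: `σ₀ := min`, slacks
`η₁ := η/2` (kinetic), `η₂ := η·Cd/(2(g₀ᵏσ³ + 1)·…)` (domination), confidences `δ/2`; `r₀` from the domination item, `λ := max λ₀ λ₀'`,
`N₀ := max`; then `measure_deficit_le_add` after ζ-reducing the two `let`-chains (they share `ε, G, γ, Θ, pv, Kc` verbatim and differ only in the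
mollifier scale). [folklore] -/
theorem rateFloor_of_kinetic_of_subgrid (hkin : RateFloorKinetic) (hsub : SubgridDomination) : RateFloor := by
  obtain ⟨gk, hgk, hkin⟩ := hkin
  obtain ⟨Cd, hCd, hsub⟩ := hsub
  refine ⟨gk / Cd, by positivity, fun a₀ θ₀ u₀ ha hθ hu ha0 hθ0 => ?_⟩
  obtain ⟨σa, hσa, hkin⟩ := hkin a₀ θ₀ u₀ ha hθ hu ha0 hθ0
  obtain ⟨σb, hσb, hsub⟩ := hsub a₀ θ₀ u₀ ha hθ hu ha0 hθ0
  refine ⟨min σa σb, lt_min hσa hσb, ?_⟩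
  intro σ hσ hσlt Φ τ hτ χ hχc hχ0 Ξ hΞc hΞ0 hΞC η δ hη hδ
  have hσa' : σ < σa := hσlt.trans_le (min_le_left _ _)
  have hσb' : σ < σb := hσlt.trans_le (min_le_right _ _)
  have hs : (0 : ℝ) ≤ σ ^ 3 := by positivity
  -- slacks
  set η₂ : ℝ := η / (2 * (gk / Cd * σ ^ 3 + 1)) with hη₂
  have hη₂pos : 0 < η₂ := by positivity
  have hsplit : η / 2 + gk / Cd * σ ^ 3 * η₂ ≤ η := by
    have hc : 0 ≤ gk / Cd * σ ^ 3 := by positivity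
    have h1 : gk / Cd * σ ^ 3 * η₂ ≤ η / 2 := by
      rw [hη₂]
      rw [show gk / Cd * σ ^ 3 * (η / (2 * (gk / Cd * σ ^ 3 + 1))) = η / 2 * (gk / Cd * σ ^ 3 / (gk / Cd * σ ^ 3 + 1)) by
        field_simp]
      have h2 : gk / Cd * σ ^ 3 / (gk / Cd * σ ^ 3 + 1) ≤ 1 := (div_le_one (by positivity)).2 (by linarith)
      exact mul_le_of_le_one_right (by positivity) h2
    linarith
  obtain ⟨lam₀, hlam₀, hkin⟩ := hkin σ hσ hσa' Φ τ hτ χ hχc hχ0 Ξ hΞc hΞ0 hΞC (η / 2) (δ / 2) (by positivity) (by positivity)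
  obtain ⟨r₀, hr₀, hsub⟩ := hsub σ hσ hσb' Φ τ hτ χ hχc hχ0 Ξ hΞc hΞ0 hΞC η₂ (δ / 2) hη₂pos (by positivity)
  refine ⟨r₀, hr₀, fun r hr hrlt => ?_⟩
  obtain ⟨lam₀', hlam₀', hsub⟩ := hsub r hr hrlt
  obtain ⟨Na, hkin⟩ := hkin (max lam₀ lam₀') (le_max_left _ _)
  obtain ⟨Nb, hsub⟩ := hsub (max lam₀ lam₀') (le_max_right _ _)
  refine ⟨max Na Nb, fun N hN => ?_⟩
  have e1 := hkin N ((le_max_left _ _).trans hN)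
  have e2 := hsub N ((le_max_right _ _).trans hN)
  dsimp only at e1 e2 ⊢
  have h := measure_deficit_le_add (Literature.MathematicalPhysics.KineticTheory.localGibbsLaw σ a₀ u₀ θ₀ N (Φ N)) _ _ _
    hgk.le hCd hs hsplit e1 e2
  refine h.trans ?_
  rw [← ENNReal.ofReal_add (by positivity) (by positivity), add_halves]
-- adapted from Cruxes/RateFloor/Lines/SketchSplit.lean (c4): end verbatim copy

/-! ## §0 The three statements of the line (defs; the registered stubs below repeat S1/S2 verbatim) -/

/-- **`CutRateFloorKinetic`** — the crux at the KINETIC scale `R_N = λ(N+1)^{-1/3}` and for the density-CUT functional: with a continuous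
cutoff `0 ≤ g ≤ 1`, `g = 1` on `(−∞, η₀/2]`, `g = 0` on `[η₀, ∞)`, evaluated at the reduced mollified density `σ³ρ_{R_N}` (at `x_i` on the collision side, at `x` on
the ideal side — the convention of items 13078/13079), `K_N[χ g Ξ] ≥ g₁σ³∫₀^τ∫χ g B^Ξ_{R_N} − η` in local-Gibbs probability
(`∃ g₁ ∃ η₀ ∀ profiles ∃ σ₀ ∀ σ Φ τ χ Ξ g ∀ η δ ∃ λ₀ ∀ λ ∃ N₀ ∀ N`).  This is what the idea's lever delivers (PROVED below from S1). [folklore] -/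
def CutRateFloorKinetic : Prop :=
  ∃ g₁ : ℝ, 0 < g₁ ∧ ∃ η₀ : ℝ, 0 < η₀ ∧ ∀ (a₀ θ₀ : Literature.MathematicalPhysics.KineticTheory.T3 → ℝ) (u₀ : Literature.MathematicalPhysics.KineticTheory.T3 → Literature.MathematicalPhysics.KineticTheory.V3), Continuous a₀ → Continuous θ₀ → Continuous u₀ → (∀ x, 0 < a₀ x) → (∀ x, 0 < θ₀ x) → ∃ σ₀ : ℝ, 0 < σ₀ ∧ ∀ σ : ℝ, 0 < σ → σ < σ₀ → ∀ Φ : (N : ℕ) → Literature.Analysis.FluidPDE.HardSphereFlow (Literature.Analysis.FluidPDE.Torus.geometry (Fin 3)) (Literature.MathematicalPhysics.KineticTheory.hsDiameter σ N) (N + 1), ∀ τ : ℝ, 0 < τ → ∀ χ : ℝ × UnitAddTorus (Fin 3) → ℝ, Continuous χ → (∀ p, 0 ≤ χ p) → ∀ Ξ : EuclideanSpace ℝ (Fin 3) × EuclideanSpace ℝ (Fin 3) × EuclideanSpace ℝ (Fin 3) → ℝ, Continuous Ξ → (∀ q, 0 ≤ Ξ q) → (∃ C : ℝ, ∀ q,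 Ξ q ≤ C) → ∀ g : ℝ → ℝ, Continuous g → (∀ a, 0 ≤ g a) → (∀ a, g a ≤ 1) → (∀ a, a ≤ η₀ / 2 → g a = 1) → (∀ a, η₀ ≤ a → g a = 0) → ∀ η δ : ℝ, 0 < η → 0 < δ → ∃ lam₀ : ℝ, 0 < lam₀ ∧ ∀ lam : ℝ, lam₀ ≤ lam → ∃ N₀ : ℕ, ∀ N : ℕ, N₀ ≤ N → let r : ℝ := lam * ((N + 1 : ℕ) : ℝ) ^ (-(1 / 3 : ℝ)); let ε := Literature.MathematicalPhysics.KineticTheory.hsDiameter σ N; let G := Literature.Analysis.FluidPDE.Torus.geometry (Fin 3); let γ := fun z (s : ℝ) => (Φ N).flow s z; let bx : UnitAddTorus (Fin 3) → UnitAddTorus (Fin 3) → ℝ := fun x y => 3 / (Real.pi * r ^ 3) * max (1 - Literature.Analysis.FluidPDE.Torus.euclidDist x y / r) 0; let ρm := fun z s (x₀ : UnitAddTorus (Fin 3)) => ∫ q, bx q.1 x₀ ∂(Literature.Analysis.FluidPDE.empiricalMeasure (γ z s)); let Θ := fun (Ξ : EuclideanSpace ℝ (Fin 3) × EuclideanSpace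 ℝ (Fin 3) × EuclideanSpace ℝ (Fin 3) → ℝ) (v w : EuclideanSpace ℝ (Fin 3)) => ∫ ω : Metric.sphere (0 : EuclideanSpace ℝ (Fin 3)) 1, Ξ ((ω : EuclideanSpace ℝ (Fin 3)), v, w) * Literature.MathematicalPhysics.KineticTheory.hardSphereKernel (w, v) ω ∂Literature.MathematicalPhysics.KineticTheory.sphereMeasure; let B := fun Ξ z s (x₀ : UnitAddTorus (Fin 3)) => ∫ p, bx p.1.1 x₀ * bx p.2.1 x₀ * Θ Ξ p.1.2 p.2.2 ∂((Literature.Analysis.FluidPDE.empiricalMeasure (γ z s)).prod (Literature.Analysis.FluidPDE.empiricalMeasure (γ z s))); let pv := fun z s (i j : Fin (N + 1)) => Literature.Analysis.FluidPDE.reflectVel (G.sepVec (γ z s i).1 (γ z s j).1) ((γ z s i).2, (γ z s j).2); let Kc := fun (Fn : Literature.Analysis.FluidPDE.Config (N + 1) (Fin 3) Literature.MathematicalPhysics.KineticTheory.T3 → ℝ → Fin (N + 1) → Fin (N + 1) → ℝ) z => ε / (N + 1 : ℝ) * ∑ᶠ (s : ℝ) (_ : s ∈ Literature.Analysis.FluidPDE.collisionTimes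 G ε (γ z) ∩ Set.Icc 0 τ), ∑ i : Fin (N + 1), ∑ j : Fin (N + 1), (if i ≠ j ∧ ‖G.sepVec (γ z s i).1 (γ z s j).1‖ = ε then Fn z s i j else 0); Literature.MathematicalPhysics.KineticTheory.localGibbsLaw σ a₀ u₀ θ₀ N (Φ N) {z | Kc (fun z s i j => χ (s, (γ z s i).1) * g (σ ^ 3 * ρm z s (γ z s i).1) * Ξ (ε⁻¹ • G.sepVec (γ z s i).1 (γ z s j).1, (pv z s i j).1, (pv z s i j).2)) z < g₁ * σ ^ 3 * (∫ s in Set.Icc (0 : ℝ) τ, ∫ x : UnitAddTorus (Fin 3), χ (s, x) * g (σ ^ 3 * ρm z s x) * B Ξ z s x) - η} ≤ ENNReal.ofReal δ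

/-- **`EqSuperExpDeficitCutKinetic`** (= registered stub S1, `E1_cut@R_N` of TRIAGE r1-2/r1-3 ≡ `SELcut_R` of the merge partner
`cut-deficit-residence-pricing`): under the flow-invariant homogeneous Gibbs law `G_N = localGibbsLaw σ 1 0 1 N (Φ N)` the CUT kinetic-scale
deficit event has probability `≤ exp(−L(N+1))` for EVERY `L`, once `λ ≥ λ₀(L, …)` and `N ≥ N₀` — a statement about ONE explicit reversible
stationary measure, no profiles. [folklore] -/
def EqSuperExpDeficitCutKinetic : Prop :=
  ∃ g₁ : ℝ, 0 < g₁ ∧ ∃ η₀ : ℝ, 0 < η₀ ∧ ∃ σ₀ : ℝ, 0 < σ₀ ∧ ∀ σ : ℝ, 0 < σ → σ < σ₀ → ∀ Φ : (N : ℕ) → Literature.Analysis.FluidPDE.HardSphereFlow (Literature.Analysis.FluidPDE.Torus.geometry (Fin 3)) (Literature.MathematicalPhysics.KineticTheory.hsDiameter σ N) (N + 1), ∀ τ : ℝ, 0 < τ → ∀ χ : ℝ × UnitAddTorus (Fin 3) → ℝ, Continuous χ → (∀ p, 0 ≤ χ p) → ∀ Ξ : EuclideanSpace ℝ (Fin 3)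 × EuclideanSpace ℝ (Fin 3) × EuclideanSpace ℝ (Fin 3) → ℝ, Continuous Ξ → (∀ q, 0 ≤ Ξ q) → (∃ C : ℝ, ∀ q, Ξ q ≤ C) → ∀ g : ℝ → ℝ, Continuous g → (∀ a, 0 ≤ g a) → (∀ a, g a ≤ 1) → (∀ a, a ≤ η₀ / 2 → g a = 1) → (∀ a, η₀ ≤ a → g a = 0) → ∀ η : ℝ, 0 < η → ∀ L : ℝ, ∃ lam₀ : ℝ, 0 < lam₀ ∧ ∀ lam : ℝ, lam₀ ≤ lam → ∃ N₀ : ℕ, ∀ N : ℕ, N₀ ≤ N → let r : ℝ := lam * ((N + 1 : ℕ) : ℝ) ^ (-(1 / 3 : ℝ)); let ε := Literature.MathematicalPhysics.KineticTheory.hsDiameter σ N; let G := Literature.Analysis.FluidPDE.Torus.geometry (Fin 3); let γ := fun z (s : ℝ) => (Φ N).flow s z; let bx : UnitAddTorus (Fin 3) → UnitAddTorus (Fin 3) → ℝ := fun x y => 3 / (Real.pi * r ^ 3) * max (1 - Literature.Analysis.FluidPDE.Torus.euclidDist x y / r) 0; let ρm := fun z s (x₀ : UnitAddTorus (Fin 3))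 => ∫ q, bx q.1 x₀ ∂(Literature.Analysis.FluidPDE.empiricalMeasure (γ z s)); let Θ := fun (Ξ : EuclideanSpace ℝ (Fin 3) × EuclideanSpace ℝ (Fin 3) × EuclideanSpace ℝ (Fin 3) → ℝ) (v w : EuclideanSpace ℝ (Fin 3)) => ∫ ω : Metric.sphere (0 : EuclideanSpace ℝ (Fin 3)) 1, Ξ ((ω : EuclideanSpace ℝ (Fin 3)), v, w) * Literature.MathematicalPhysics.KineticTheory.hardSphereKernel (w, v) ω ∂Literature.MathematicalPhysics.KineticTheory.sphereMeasure; let B := fun Ξ z s (x₀ : UnitAddTorus (Fin 3)) => ∫ p, bx p.1.1 x₀ * bx p.2.1 x₀ * Θ Ξ p.1.2 p.2.2 ∂((Literature.Analysis.FluidPDE.empiricalMeasure (γ z s)).prod (Literature.Analysis.FluidPDE.empiricalMeasure (γ z s))); let pv := fun z s (i j : Fin (N + 1)) => Literature.Analysis.FluidPDE.reflectVel (G.sepVec (γ z s i).1 (γ z s j).1) ((γ z s i).2, (γ z s j).2); let Kc := fun (Fn : Literature.Analysis.FluidPDE.Config (N + 1) (Fin 3) Literature.MathematicalPhysics.KineticTheory.T3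 → ℝ → Fin (N + 1) → Fin (N + 1) → ℝ) z => ε / (N + 1 : ℝ) * ∑ᶠ (s : ℝ) (_ : s ∈ Literature.Analysis.FluidPDE.collisionTimes G ε (γ z) ∩ Set.Icc 0 τ), ∑ i : Fin (N + 1), ∑ j : Fin (N + 1), (if i ≠ j ∧ ‖G.sepVec (γ z s i).1 (γ z s j).1‖ = ε then Fn z s i j else 0); Literature.MathematicalPhysics.KineticTheory.localGibbsLaw σ (fun _ => (1 : ℝ)) (fun _ => (0 : EuclideanSpace ℝ (Fin 3))) (fun _ => (1 : ℝ)) N (Φ N) {z | Kc (fun z s i j => χ (s, (γ z s i).1) * g (σ ^ 3 * ρm z s (γ z s i).1) * Ξ (ε⁻¹ • G.sepVec (γ z s i).1 (γ z s j).1, (pv z s i j).1, (pv z s i j).2)) z < g₁ * σ ^ 3 * (∫ s in Set.Icc (0 : ℝ) τ, ∫ x : UnitAddTorus (Fin 3), χ (s, x) * g (σ ^ 3 * ρm z s x) * B Ξ z s x) - η} ≤ ENNReal.ofReal (Real.exp (-(L * ((N : ℝ) + 1))))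

/-- **`DenseRemainderKinetic`** (= registered stub S2): the collisions the cut DISCOUNTS (weight `1 − g(σ³ρ_{R_N}(x_i))`, all at reduced
density `> η₁`) still come at `≥ g₂ ×` the ideal rate the cut discounts, in local-Gibbs probability, for dilute enough data
(`∃ g₂ ∀ η₁ ∀ profiles ∃ σ₀(η₁, profiles) …`; difference form, so that the composition is pure arithmetic). [folklore] -/
def DenseRemainderKinetic : Prop :=
  ∃ g₂ : ℝ, 0 < g₂ ∧ ∀ η₁ : ℝ, 0 < η₁ → ∀ (a₀ θ₀ : Literature.MathematicalPhysics.KineticTheory.T3 → ℝ) (u₀ : Literature.MathematicalPhysics.KineticTheory.T3 → Literature.MathematicalPhysics.KineticTheory.V3), Continuous a₀ → Continuous θ₀ → Continuous u₀ → (∀ x, 0 < a₀ x) → (∀ x, 0 < θ₀ x) → ∃ σ₀ : ℝ, 0 < σ₀ ∧ ∀ σ : ℝ, 0 < σ → σ < σ₀ → ∀ Φ : (N : ℕ) → Literature.Analysis.FluidPDE.HardSphereFlow (Literature.Analysis.FluidPDE.Torus.geometry (Fin 3)) (Literature.MathematicalPhysics.KineticTheory.hsDiameter σ N) (N + 1),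 ∀ τ : ℝ, 0 < τ → ∀ χ : ℝ × UnitAddTorus (Fin 3) → ℝ, Continuous χ → (∀ p, 0 ≤ χ p) → ∀ Ξ : EuclideanSpace ℝ (Fin 3) × EuclideanSpace ℝ (Fin 3) × EuclideanSpace ℝ (Fin 3) → ℝ, Continuous Ξ → (∀ q, 0 ≤ Ξ q) → (∃ C : ℝ, ∀ q, Ξ q ≤ C) → ∀ g : ℝ → ℝ, Continuous g → (∀ a, 0 ≤ g a) → (∀ a, g a ≤ 1) → (∀ a, a ≤ η₁ → g a = 1) → ∀ η δ : ℝ, 0 < η → 0 < δ → ∃ lam₀ : ℝ, 0 < lam₀ ∧ ∀ lam : ℝ, lam₀ ≤ lam → ∃ N₀ : ℕ, ∀ N : ℕ, N₀ ≤ N → let r : ℝ := lam * ((N + 1 : ℕ) : ℝ) ^ (-(1 / 3 : ℝ)); let ε := Literature.MathematicalPhysics.KineticTheory.hsDiameter σ N; let G := Literature.Analysis.FluidPDE.Torus.geometry (Fin 3); let γ := fun z (s : ℝ) => (Φ N).flow s z; let bx : UnitAddTorus (Fin 3) → UnitAddTorus (Fin 3) → ℝ := fun x y => 3 / (Real.pi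 * r ^ 3) * max (1 - Literature.Analysis.FluidPDE.Torus.euclidDist x y / r) 0; let ρm := fun z s (x₀ : UnitAddTorus (Fin 3)) => ∫ q, bx q.1 x₀ ∂(Literature.Analysis.FluidPDE.empiricalMeasure (γ z s)); let Θ := fun (Ξ : EuclideanSpace ℝ (Fin 3) × EuclideanSpace ℝ (Fin 3) × EuclideanSpace ℝ (Fin 3) → ℝ) (v w : EuclideanSpace ℝ (Fin 3)) => ∫ ω : Metric.sphere (0 : EuclideanSpace ℝ (Fin 3)) 1, Ξ ((ω : EuclideanSpace ℝ (Fin 3)), v, w) * Literature.MathematicalPhysics.KineticTheory.hardSphereKernel (w, v) ω ∂Literature.MathematicalPhysics.KineticTheory.sphereMeasure; let B := fun Ξ z s (x₀ : UnitAddTorus (Fin 3)) => ∫ p, bx p.1.1 x₀ * bx p.2.1 x₀ * Θ Ξ p.1.2 p.2.2 ∂((Literature.Analysis.FluidPDE.empiricalMeasure (γ z s)).prod (Literature.Analysis.FluidPDE.empiricalMeasure (γ z s))); let pv := fun z s (i j : Fin (N + 1)) => Literature.Analysis.FluidPDE.reflectVel (G.sepVec (γ z s i).1 (γ z s j).1)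 ((γ z s i).2, (γ z s j).2); let Kc := fun (Fn : Literature.Analysis.FluidPDE.Config (N + 1) (Fin 3) Literature.MathematicalPhysics.KineticTheory.T3 → ℝ → Fin (N + 1) → Fin (N + 1) → ℝ) z => ε / (N + 1 : ℝ) * ∑ᶠ (s : ℝ) (_ : s ∈ Literature.Analysis.FluidPDE.collisionTimes G ε (γ z) ∩ Set.Icc 0 τ), ∑ i : Fin (N + 1), ∑ j : Fin (N + 1), (if i ≠ j ∧ ‖G.sepVec (γ z s i).1 (γ z s j).1‖ = ε then Fn z s i j else 0); Literature.MathematicalPhysics.KineticTheory.localGibbsLaw σ a₀ u₀ θ₀ N (Φ N) {z | Kc (fun z s i j => χ (s, (γ z s i).1) * Ξ (ε⁻¹ • G.sepVec (γ z s i).1 (γ z s j).1, (pv z s i j).1, (pv z s i j).2)) z - Kc (fun z s i j => χ (s, (γ z s i).1) * g (σ ^ 3 * ρm z s (γ z s i).1) * Ξ (ε⁻¹ • G.sepVec (γ z s i).1 (γ z s j).1, (pv z s i j).1, (pv z s i j).2)) z < g₂ * σ ^ 3 * ((∫ s in Set.Icc (0 : ℝ) τ, ∫ x : UnitAddTorus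 (Fin 3), χ (s, x) * B Ξ z s x) - (∫ s in Set.Icc (0 : ℝ) τ, ∫ x : UnitAddTorus (Fin 3), χ (s, x) * g (σ ^ 3 * ρm z s x) * B Ξ z s x)) - η} ≤ ENNReal.ofReal δ

/-! ## §1 Registered stubs (the ONLY sorries of this file) -/

/-- **S1 · `stub_eqSuperExpDeficitCut` — THE BET of the line (hardest stub; size XL; equilibrium only).**
Under `G_N = localGibbsLaw σ 1 0 1 N (Φ N)` (canonical hard-sphere Gibbs law at reduced density `σ³`, Maxwellian velocities; invariant under
every hard-sphere flow `Φ N`), for `σ < σ₀` (universal), every horizon `τ`, weight `χ ≥ 0`, bounded mark `Ξ ≥ 0`, cutoff `0 ≤ g ≤ 1`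
(`= 1` on `(−∞,η₀/2]`, `= 0` on `[η₀,∞)`), slack `η > 0` and rate `L`: for `λ ≥ λ₀(σ,τ,χ,Ξ,g,η,L)` and `N ≥ N₀`,
`G_N{ K_N[χ g(σ³ρ_R(x_i)) Ξ] < g₁σ³∫₀^τ∫χ g(σ³ρ_R) B^Ξ_R − η } ≤ e^{−L(N+1)}`, `R = λ(N+1)^{-1/3}`.
WHY PLAUSIBLE: a collision-RATIO deficit against the kinetic-scale chaos functional needs positional AVOIDANCE correlated with velocities
(combing/laning: velocity precision `≍ spacing/τ`, Gibbs cost `≍ N log N`, TRIAGE r1-3 N2) or sub-`R_N` structure re-created `≍ τc̄N^{1/3}/λ²`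
times at extensive cost each (`≍ N^{4/3}`); dense/caged pockets are removed by the cut on both sides (r1-1 W1); r-scale hydrodynamic shear,
expansion, temperature structure are invisible to the ratio at scale `R_N` ("hydro-immune": `B_R` is built from the same empirical measure);
equilibrium mean = Enskog `Y(σ³) ≥ 1 >` any `g₁ < 1` (Disproof §6, Kac/Santaló), so the event is a genuine lower tail.  Honest rate: `≤ (1+o(1))N log N`
(laned state), so `∀ L` is the right currency and `h_N ≍ log N` the target.  WHY IT MIGHT FAIL: an `e^{-O(N)}`-probable family of equilibrium
data whose DETERMINISTIC evolution re-creates kinetic-scale velocity–position order over a macroscopic window without paying again (echo-type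
states); or loss of the cut's protection at moderate densities `η₁ < σ³ρ < η₀` (none known below freezing).  NOT an instance of
`Negative/RAfterN` (λ before N, `λ/σ ≫ 2` built into `λ₀`) nor of `Negative/WithoutEtaPos` (`0 < η` hypothesis kept).  Leans on (for a proof):
flow-invariance of `G_N` (`map_flow_localGibbsLaw_const`), the landed rung-0 statics (`Theorems.RateFloorRung0`, p123815: mean and one-window variance),
`lintegral_collisionCylinder`; MISSING: an N-uniform multi-window (process-level) decorrelation of the equilibrium hard-sphere flow at the
kinetic time scale (c6 `Lines/SketchDead.md` §4) — window-start statics alone certify rate `≤ νΔ/2` (c6 cap (i)), so the proof must be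
genuinely multi-time. [size XL] -/
theorem stub_eqSuperExpDeficitCut :
    ∃ g₁ : ℝ, 0 < g₁ ∧ ∃ η₀ : ℝ, 0 < η₀ ∧ ∃ σ₀ : ℝ, 0 < σ₀ ∧ ∀ σ : ℝ, 0 < σ → σ < σ₀ → ∀ Φ : (N : ℕ) → Literature.Analysis.FluidPDE.HardSphereFlow (Literature.Analysis.FluidPDE.Torus.geometry (Fin 3)) (Literature.MathematicalPhysics.KineticTheory.hsDiameter σ N) (N + 1), ∀ τ : ℝ, 0 < τ → ∀ χ : ℝ × UnitAddTorus (Fin 3) → ℝ, Continuous χ → (∀ p, 0 ≤ χ p) → ∀ Ξ : EuclideanSpace ℝ (Fin 3) × EuclideanSpace ℝ (Fin 3) × EuclideanSpace ℝ (Fin 3) → ℝ, Continuous Ξ → (∀ q, 0 ≤ Ξ q) → (∃ C : ℝ, ∀ q, Ξ q ≤ C) → ∀ g : ℝ → ℝ, Continuous g → (∀ a, 0 ≤ g a) → (∀ a, g a ≤ 1) → (∀ a, a ≤ η₀ / 2 → g a = 1) → (∀ a, η₀ ≤ a → g a = 0) → ∀ η : ℝ, 0 < η → ∀ L : ℝ,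 ∃ lam₀ : ℝ, 0 < lam₀ ∧ ∀ lam : ℝ, lam₀ ≤ lam → ∃ N₀ : ℕ, ∀ N : ℕ, N₀ ≤ N → let r : ℝ := lam * ((N + 1 : ℕ) : ℝ) ^ (-(1 / 3 : ℝ)); let ε := Literature.MathematicalPhysics.KineticTheory.hsDiameter σ N; let G := Literature.Analysis.FluidPDE.Torus.geometry (Fin 3); let γ := fun z (s : ℝ) => (Φ N).flow s z; let bx : UnitAddTorus (Fin 3) → UnitAddTorus (Fin 3) → ℝ := fun x y => 3 / (Real.pi * r ^ 3) * max (1 - Literature.Analysis.FluidPDE.Torus.euclidDist x y / r) 0; let ρm := fun z s (x₀ : UnitAddTorus (Fin 3)) => ∫ q, bx q.1 x₀ ∂(Literature.Analysis.FluidPDE.empiricalMeasure (γ z s)); let Θ := fun (Ξ : EuclideanSpace ℝ (Fin 3) × EuclideanSpace ℝ (Fin 3) × EuclideanSpace ℝ (Fin 3) → ℝ) (v w : EuclideanSpace ℝ (Fin 3)) => ∫ ω : Metric.sphere (0 : EuclideanSpace ℝ (Fin 3)) 1, Ξ ((ω : EuclideanSpace ℝ (Fin 3)), v, w) * Literature.MathematicalPhysics.KineticTheory.hardSphereKernel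 (w, v) ω ∂Literature.MathematicalPhysics.KineticTheory.sphereMeasure; let B := fun Ξ z s (x₀ : UnitAddTorus (Fin 3)) => ∫ p, bx p.1.1 x₀ * bx p.2.1 x₀ * Θ Ξ p.1.2 p.2.2 ∂((Literature.Analysis.FluidPDE.empiricalMeasure (γ z s)).prod (Literature.Analysis.FluidPDE.empiricalMeasure (γ z s))); let pv := fun z s (i j : Fin (N + 1)) => Literature.Analysis.FluidPDE.reflectVel (G.sepVec (γ z s i).1 (γ z s j).1) ((γ z s i).2, (γ z s j).2); let Kc := fun (Fn : Literature.Analysis.FluidPDE.Config (N + 1) (Fin 3) Literature.MathematicalPhysics.KineticTheory.T3 → ℝ → Fin (N + 1) → Fin (N + 1) → ℝ) z => ε / (N + 1 : ℝ) * ∑ᶠ (s : ℝ) (_ : s ∈ Literature.Analysis.FluidPDE.collisionTimes G ε (γ z) ∩ Set.Icc 0 τ), ∑ i : Fin (N + 1), ∑ j : Fin (N + 1), (if i ≠ j ∧ ‖G.sepVec (γ z s i).1 (γ z s j).1‖ = ε then Fn z s i j else 0); Literature.MathematicalPhysics.KineticTheory.localGibbsLaw σ (fun _ => (1 : ℝ))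 (fun _ => (0 : EuclideanSpace ℝ (Fin 3))) (fun _ => (1 : ℝ)) N (Φ N) {z | Kc (fun z s i j => χ (s, (γ z s i).1) * g (σ ^ 3 * ρm z s (γ z s i).1) * Ξ (ε⁻¹ • G.sepVec (γ z s i).1 (γ z s j).1, (pv z s i j).1, (pv z s i j).2)) z < g₁ * σ ^ 3 * (∫ s in Set.Icc (0 : ℝ) τ, ∫ x : UnitAddTorus (Fin 3), χ (s, x) * g (σ ^ 3 * ρm z s x) * B Ξ z s x) - η} ≤ ENNReal.ofReal (Real.exp (-(L * ((N : ℝ) + 1)))) := by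
  sorry

/-- **S2 · `stub_denseRemainderFloor` — the DENSE COMPLEMENT of the filed (uncut) crux (size L; non-equilibrium; the restatement debt
"DenseComplement(∀η at fixed σ)" of TRIAGE r1-2 (R) / r1-3 N1, typed).**  For every density threshold `η₁ > 0` and all profiles there is
`σ₀(η₁, profiles)` such that along the local-Gibbs flow, for every cutoff `0 ≤ g ≤ 1` with `g = 1` on `(−∞, η₁]`, the DISCOUNTED collisions
`K_N[χΞ] − K_N[χ g(σ³ρ_R(x_i)) Ξ]` (all involving a particle at reduced mollified density `> η₁`) are at least
`g₂σ³(∫χB^Ξ_R − ∫χ g B^Ξ_R) − η` with probability `≥ 1 − δ` (`λ ≥ λ₀`, `N ≥ N₀`).  WHY PLAUSIBLE: for `σ < σ₀(η₁, profiles)` the data sit at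
reduced density `≪ η₁`; as long as the flow creates no excursion above `η₁` both sides vanish up to the `O(R_N)`-volume mismatch layer between
`g(·(x_i))` and `g(·(x))` (absorbed by `η`, `N₀` after `η`) and the event is empty (`Kc ≥ 0`, Disproof §2); where the flow DOES compress (converging
streams, post-shock stagnation, implosion cores at `τ` past the classical time) the dense fluid collides at the Enskog rate `Y(σ³ρ) ≫ 1 ×` ideal
for every mark.  Under the horizon guard `τ < T` + `DensityCap` (13082) the remainder is empty and S2 is immediate — its whole exposure is the
filed `∀ τ`.  WHY IT MIGHT FAIL: shock-induced ORIENTED crystallisation of an implosion/stagnation core at fixed `σ` (close-packed planes ∥ the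
front) met by a mark `Ξ` vanishing on the three contact rings — a dynamical cousin of W1 that the cut no longer removes because here it is the
remainder; needs unbounded compression profiles (MRRS-type implosions), i.e. exactly the `DiluteSelfConsistency` hazard of the route.  NOT
entropy-accessible (W1 under `G_N` costs only `e^{-c(η)N}`: transfer vacuous, r1-2 S3 "G_dense walled") — a statement about the non-equilibrium
flow; `g ≡ 0` is excluded by `g = 1` on `(−∞, η₁]`, so S2 is NOT the kinetic crux in costume. [size L] -/
theorem stub_denseRemainderFloor :
    ∃ g₂ : ℝ, 0 < g₂ ∧ ∀ η₁ : ℝ, 0 < η₁ → ∀ (a₀ θ₀ : Literature.MathematicalPhysics.KineticTheory.T3 → ℝ) (u₀ : Literature.MathematicalPhysics.KineticTheory.T3 → Literature.MathematicalPhysics.KineticTheory.V3), Continuous a₀ → Continuous θ₀ → Continuous u₀ → (∀ x, 0 < a₀ x) → (∀ x, 0 < θ₀ x) → ∃ σ₀ : ℝ, 0 < σ₀ ∧ ∀ σ : ℝ, 0 < σ → σ < σ₀ → ∀ Φ : (N : ℕ) → Literature.Analysis.FluidPDE.HardSphereFlow (Literature.Analysis.FluidPDE.Torus.geometry (Fin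 3)) (Literature.MathematicalPhysics.KineticTheory.hsDiameter σ N) (N + 1), ∀ τ : ℝ, 0 < τ → ∀ χ : ℝ × UnitAddTorus (Fin 3) → ℝ, Continuous χ → (∀ p, 0 ≤ χ p) → ∀ Ξ : EuclideanSpace ℝ (Fin 3) × EuclideanSpace ℝ (Fin 3) × EuclideanSpace ℝ (Fin 3) → ℝ, Continuous Ξ → (∀ q, 0 ≤ Ξ q) → (∃ C : ℝ, ∀ q, Ξ q ≤ C) → ∀ g : ℝ → ℝ, Continuous g → (∀ a, 0 ≤ g a) → (∀ a, g a ≤ 1) → (∀ a, a ≤ η₁ → g a = 1) → ∀ η δ : ℝ, 0 < η → 0 < δ → ∃ lam₀ : ℝ, 0 < lam₀ ∧ ∀ lam : ℝ, lam₀ ≤ lam → ∃ N₀ : ℕ, ∀ N : ℕ, N₀ ≤ N → let r : ℝ := lam * ((N + 1 : ℕ) : ℝ) ^ (-(1 / 3 : ℝ)); let ε := Literature.MathematicalPhysics.KineticTheory.hsDiameter σ N; let G := Literature.Analysis.FluidPDE.Torus.geometry (Fin 3); let γ := fun z (s : ℝ) => (Φ N).flow s z; let bx : UnitAddTorus (Fin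 3) → UnitAddTorus (Fin 3) → ℝ := fun x y => 3 / (Real.pi * r ^ 3) * max (1 - Literature.Analysis.FluidPDE.Torus.euclidDist x y / r) 0; let ρm := fun z s (x₀ : UnitAddTorus (Fin 3)) => ∫ q, bx q.1 x₀ ∂(Literature.Analysis.FluidPDE.empiricalMeasure (γ z s)); let Θ := fun (Ξ : EuclideanSpace ℝ (Fin 3) × EuclideanSpace ℝ (Fin 3) × EuclideanSpace ℝ (Fin 3) → ℝ) (v w : EuclideanSpace ℝ (Fin 3)) => ∫ ω : Metric.sphere (0 : EuclideanSpace ℝ (Fin 3)) 1, Ξ ((ω : EuclideanSpace ℝ (Fin 3)), v, w) * Literature.MathematicalPhysics.KineticTheory.hardSphereKernel (w, v) ω ∂Literature.MathematicalPhysics.KineticTheory.sphereMeasure; let B := fun Ξ z s (x₀ : UnitAddTorus (Fin 3)) => ∫ p, bx p.1.1 x₀ * bx p.2.1 x₀ * Θ Ξ p.1.2 p.2.2 ∂((Literature.Analysis.FluidPDE.empiricalMeasure (γ z s)).prod (Literature.Analysis.FluidPDE.empiricalMeasure (γ z s))); let pv := fun z s (i j : Fin (N + 1)) => Literature.Analysis.FluidPDE.reflectVel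 (G.sepVec (γ z s i).1 (γ z s j).1) ((γ z s i).2, (γ z s j).2); let Kc := fun (Fn : Literature.Analysis.FluidPDE.Config (N + 1) (Fin 3) Literature.MathematicalPhysics.KineticTheory.T3 → ℝ → Fin (N + 1) → Fin (N + 1) → ℝ) z => ε / (N + 1 : ℝ) * ∑ᶠ (s : ℝ) (_ : s ∈ Literature.Analysis.FluidPDE.collisionTimes G ε (γ z) ∩ Set.Icc 0 τ), ∑ i : Fin (N + 1), ∑ j : Fin (N + 1), (if i ≠ j ∧ ‖G.sepVec (γ z s i).1 (γ z s j).1‖ = ε then Fn z s i j else 0); Literature.MathematicalPhysics.KineticTheory.localGibbsLaw σ a₀ u₀ θ₀ N (Φ N) {z | Kc (fun z s i j => χ (s, (γ z s i).1) * Ξ (ε⁻¹ • G.sepVec (γ z s i).1 (γ z s j).1, (pv z s i j).1, (pv z s i j).2)) z - Kc (fun z s i j => χ (s, (γ z s i).1) * g (σ ^ 3 * ρm z s (γ z s i).1) * Ξ (ε⁻¹ • G.sepVec (γ z s i).1 (γ z s j).1, (pv z s i j).1, (pv z s i j).2)) z < g₂ * σ ^ 3 * ((∫ s in Set.Icc (0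 : ℝ) τ, ∫ x : UnitAddTorus (Fin 3), χ (s, x) * B Ξ z s x) - (∫ s in Set.Icc (0 : ℝ) τ, ∫ x : UnitAddTorus (Fin 3), χ (s, x) * g (σ ^ 3 * ρm z s x) * B Ξ z s x)) - η} ≤ ENNReal.ofReal δ := by
  sorry

/-- **S3 · `stub_subgridDomination` — the r-STEP of the filed (r-scale, ∀τ) crux (open; hydrodynamic regularity; the restatement debt
"S_seg / T2 / (R) / ErgodicLocalStates" common to all five cards, typed by lead c4 as `SketchSplit.SubgridDomination`, VERBATIM).**  Along the
local-Gibbs flow the `r`-mollified ideal pair functional is dominated in probability by a universal multiple `Cd` of the kinetic-scale one plus `η`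
(`∃ Cd ∀ profiles ∃ σ₀ ∀ … ∀ η δ ∃ r₀ ∀ r ∃ λ₀ ∀ λ ∃ N₀ ∀ N`).  WHY PLAUSIBLE: density-wise finer mollification only increases the functional
(Jensen, Disproof §6); velocity-wise `B_r > Cd·B_R` on positive `B`-measure needs VOLUME-FILLING sub-`r` drift contrast `≳ √θ` sustained in
`supp χ` — shocks/slip surfaces are codimension one (`B`-mass `O(r)`, absorbed by `r₀` after `η`), turbulent increments `δu(r) ≍ (ε_d r)^{1/3} → 0`.
WHY IT MIGHT FAIL: anomalous kinetic energy at scale `r` along post-blow-up evolutions of smooth profiles (wild/turbulent weak Euler states with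
volume-filling sub-`r` shear of thermal amplitude).  FALSE for entropy-class data (r-scale laminar shear, c4 `ShearDeficitPersistence`), hence
beyond entropy / energy / stationarity methods — this idea's card (T2) claimed it "pre-shock via the entropy sandwich", which TRIAGE r1-2 (R)
refuted (the isentropy step is the summit at time `s`); it is registered here as the crux's debt, not as this line's mechanism, and disappears
under restatement (a). [size XL / open-problem] -/
theorem stub_subgridDomination :
    ∃ Cd : ℝ, 0 < Cd ∧ ∀ (a₀ θ₀ : Literature.MathematicalPhysics.KineticTheory.T3 → ℝ) (u₀ : Literature.MathematicalPhysics.KineticTheory.T3 → Literature.MathematicalPhysics.KineticTheory.V3), Continuous a₀ → Continuous θ₀ → Continuous u₀ → (∀ x, 0 < a₀ x) → (∀ x, 0 < θ₀ x) → ∃ σ₀ : ℝ, 0 < σ₀ ∧ ∀ σ : ℝ, 0 < σ → σ < σ₀ → ∀ Φ : (N : ℕ) → Literature.Analysis.FluidPDE.HardSphereFlow (Literature.Analysis.FluidPDE.Torus.geometry (Fin 3)) (Literature.MathematicalPhysics.KineticTheory.hsDiameter σ N) (N + 1), ∀ τ : ℝ, 0 < τ → ∀ χ : ℝ × UnitAddTorus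 (Fin 3) → ℝ, Continuous χ → (∀ p, 0 ≤ χ p) → ∀ Ξ : EuclideanSpace ℝ (Fin 3) × EuclideanSpace ℝ (Fin 3) × EuclideanSpace ℝ (Fin 3) → ℝ, Continuous Ξ → (∀ q, 0 ≤ Ξ q) → (∃ C : ℝ, ∀ q, Ξ q ≤ C) → ∀ η δ : ℝ, 0 < η → 0 < δ → ∃ r₀ : ℝ, 0 < r₀ ∧ ∀ r : ℝ, 0 < r → r < r₀ → ∃ lam₀ : ℝ, 0 < lam₀ ∧ ∀ lam : ℝ, lam₀ ≤ lam → ∃ N₀ : ℕ, ∀ N : ℕ, N₀ ≤ N → let γ := fun z (s : ℝ) => (Φ N).flow s z; let bx : UnitAddTorus (Fin 3) → UnitAddTorus (Fin 3) → ℝ := fun x y => 3 / (Real.pi * r ^ 3) * max (1 - Literature.Analysis.FluidPDE.Torus.euclidDist x y / r) 0; let bxk : UnitAddTorus (Fin 3) → UnitAddTorus (Fin 3) → ℝ := fun x y => 3 / (Real.pi * (lam * ((N + 1 : ℕ) : ℝ) ^ (-(1 / 3 : ℝ))) ^ 3) * max (1 - Literature.Analysis.FluidPDE.Torus.euclidDist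 x y / (lam * ((N + 1 : ℕ) : ℝ) ^ (-(1 / 3 : ℝ)))) 0; let Θ := fun (Ξ : EuclideanSpace ℝ (Fin 3) × EuclideanSpace ℝ (Fin 3) × EuclideanSpace ℝ (Fin 3) → ℝ) (v w : EuclideanSpace ℝ (Fin 3)) => ∫ ω : Metric.sphere (0 : EuclideanSpace ℝ (Fin 3)) 1, Ξ ((ω : EuclideanSpace ℝ (Fin 3)), v, w) * Literature.MathematicalPhysics.KineticTheory.hardSphereKernel (w, v) ω ∂Literature.MathematicalPhysics.KineticTheory.sphereMeasure; let B := fun Ξ z s (x₀ : UnitAddTorus (Fin 3)) => ∫ p, bx p.1.1 x₀ * bx p.2.1 x₀ * Θ Ξ p.1.2 p.2.2 ∂((Literature.Analysis.FluidPDE.empiricalMeasure (γ z s)).prod (Literature.Analysis.FluidPDE.empiricalMeasure (γ z s))); let Bk := fun Ξ z s (x₀ : UnitAddTorus (Fin 3)) => ∫ p, bxk p.1.1 x₀ * bxk p.2.1 x₀ * Θ Ξ p.1.2 p.2.2 ∂((Literature.Analysis.FluidPDE.empiricalMeasure (γ z s)).prod (Literature.Analysis.FluidPDE.empiricalMeasure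 (γ z s))); Literature.MathematicalPhysics.KineticTheory.localGibbsLaw σ a₀ u₀ θ₀ N (Φ N) {z | Cd * (∫ s in Set.Icc (0 : ℝ) τ, ∫ x : UnitAddTorus (Fin 3), χ (s, x) * Bk Ξ z s x) + η < (∫ s in Set.Icc (0 : ℝ) τ, ∫ x : UnitAddTorus (Fin 3), χ (s, x) * B Ξ z s x)} ≤ ENNReal.ofReal δ := by
  sorry

/-! ## §2 The KL bridge at the kinetic scale, with the cut: `S1 → CutRateFloorKinetic` (PROVED) -/

/-- **The idea's lever, typed and proved**: `EqSuperExpDeficitCutKinetic → CutRateFloorKinetic`.  Per profile take the entropy budget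
`KL(localGibbsLaw σ a₀ u₀ θ₀ ‖ G_N) ≤ A(N+1)` (`exists_localGibbsLaw_dominated`, needs `σ ≤ ½`, whence `σ₀ := min σ₀ ½`), the rate
`L := (log 2 + A + 1)/δ` in S1, and the entropy inequality for events through a measurable hull (`measure_le_of_klDiv_le_hull`,
Kipnis–Landim App. 1 Prop. 8.2): `P_N(E) ≤ (log 2 + A(N+1))/(L(N+1)) ≤ δ` (`entropy_transfer_arith`).  No flow-invariance, no measurability of
the event, no `θ₀ < 2θ_e` side condition. [cite: KipnisLandim1999, Appendix 1 Prop. 8.2] -/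
theorem cutRateFloorKinetic_of_eqSuperExpDeficitCut (h : EqSuperExpDeficitCutKinetic) : CutRateFloorKinetic := by
  obtain ⟨g₁, hg₁, η₀, hη₀, σ₁, hσ₁, h⟩ := h
  refine ⟨g₁, hg₁, η₀, hη₀, fun a₀ θ₀ u₀ ha hθ hu ha0 hθ0 => ?_⟩
  refine ⟨min σ₁ 2⁻¹, lt_min hσ₁ (by norm_num), ?_⟩
  intro σ hσ hσlt Φ τ hτ χ hχc hχ0 Ξ hΞc hΞ0 hΞC g hgc hg0 hg1 hgη₁ hgη η δ hη hδ
  have hσ₁' : σ < σ₁ := hσlt.trans_le (min_le_left _ _)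
  have hσ2 : σ ≤ 1 / 2 := by
    have := hσlt.trans_le (min_le_right σ₁ 2⁻¹)
    rw [one_div]; exact this.le
  obtain ⟨A, b, hA, hb, hdom⟩ :=
    Summit.AtomisticToContinuum.HydrodynamicLimit.Theorems.LambertianContactSwapSwapGapGibbsDomination.exists_localGibbsLaw_dominated
      ha hθ hu ha0 hθ0 hσ2
  set L : ℝ := (Real.log 2 + A + 1) / δ with hL
  have hlog : 0 < Real.log 2 := Real.log_pos (by norm_num)
  have hLpos : 0 < L := by positivity
  obtain ⟨lam₀, hlam₀, h⟩ := h σ hσ hσ₁' Φ τ hτ χ hχc hχ0 Ξ hΞc hΞ0 hΞC g hgc hg0 hg1 hgη₁ hgη η hη L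
  refine ⟨lam₀, hlam₀, fun lam hlam => ?_⟩
  obtain ⟨N₀, hN⟩ := h lam hlam
  refine ⟨N₀, fun N hNN => ?_⟩
  have h1 := hN N hNN
  dsimp only at h1 ⊢
  haveI hP : IsProbabilityMeasure (localGibbsLaw σ a₀ u₀ θ₀ N (Φ N)) :=
    isProbabilityMeasure_localGibbsLaw ha hθ hu ha0 hθ0 hσ2 N (Φ N)
  haveI : IsProbabilityMeasure (localGibbsLaw σ (fun _ => (1 : ℝ)) (fun _ => (0 : EuclideanSpace ℝ (Fin 3)))
      (fun _ => (1 : ℝ)) N (Φ N)) :=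
    isProbabilityMeasure_localGibbsLaw (a₀ := fun _ => (1 : ℝ)) (θ₀ := fun _ => (1 : ℝ))
      (u₀ := fun _ => (0 : EuclideanSpace ℝ (Fin 3))) continuous_const continuous_const continuous_const
      (fun _ => one_pos) (fun _ => one_pos) hσ2 N (Φ N)
  obtain ⟨-, -, hKL, -, -⟩ := hdom N (Φ N)
  have hn1 : (1 : ℝ) ≤ (N : ℝ) + 1 := by
    have : (0 : ℝ) ≤ (N : ℝ) := Nat.cast_nonneg N
    linarith
  have hGpos : 0 < L * ((N : ℝ) + 1) := by positivity
  have hH : (0 : ℝ) ≤ A * ((N : ℝ) + 1) := by positivity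
  have h2 := Summit.AtomisticToContinuum.HydrodynamicLimit.Theorems.RateFloorEntropyTransfer.measure_le_of_klDiv_le_hull
    (localGibbsLaw σ a₀ u₀ θ₀ N (Φ N)) _ _ hGpos hH h1 hKL
  refine h2.trans (ENNReal.ofReal_le_ofReal ?_)
  rw [hL]
  exact Summit.AtomisticToContinuum.HydrodynamicLimit.Theorems.RateFloorEntropyTransfer.entropy_transfer_arith hA hδ hn1

/-! ## §3 The additive split by the cut: `CutRateFloorKinetic → S2 → RateFloorKinetic` (PROVED) -/

/-- A continuous cutoff `0 ≤ g ≤ 1` equal to `1` on `(−∞, η₀/2]` and to `0` on `[η₀, ∞)` (piecewise linear). [folklore] -/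
theorem exists_cutoff {η₀ : ℝ} (hη₀ : 0 < η₀) :
    ∃ g : ℝ → ℝ, Continuous g ∧ (∀ a, 0 ≤ g a) ∧ (∀ a, g a ≤ 1) ∧ (∀ a, η₀ ≤ a → g a = 0) ∧
      (∀ a, a ≤ η₀ / 2 → g a = 1) := by
  refine ⟨fun a => min 1 (max 0 (2 - 2 * a / η₀)), ?_, ?_, ?_, ?_, ?_⟩
  · exact continuous_const.min (continuous_const.max (by fun_prop))
  · intro a; exact le_min zero_le_one (le_max_left _ _)
  · intro a; exact min_le_left _ _
  · intro a ha
    have h : 2 - 2 * a / η₀ ≤ 0 := by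
      rw [sub_nonpos, le_div_iff₀ hη₀]; linarith
    show min 1 (max 0 (2 - 2 * a / η₀)) = 0
    rw [max_eq_left h, min_eq_right zero_le_one]
  · intro a ha
    have h : 1 ≤ 2 - 2 * a / η₀ := by
      have : 2 * a / η₀ ≤ 1 := by rw [div_le_one hη₀]; linarith
      linarith
    show min 1 (max 0 (2 - 2 * a / η₀)) = 1
    rw [max_eq_right (by linarith), min_eq_left h]

/-- Three nonnegative reals with the middle one `≤ 1`: dropping it can only increase the product. [folklore] -/
theorem mul_mul_le_of_le_one {a b c : ℝ} (ha : 0 ≤ a) (hb : b ≤ 1) (hc : 0 ≤ c) : a * b * c ≤ a * c := by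
  nlinarith [mul_nonneg ha hc]

/-- The crux's cone weight is nonnegative at a positive scale. [folklore] -/
theorem bx_nonneg {r : ℝ} (hr : 0 < r) (d : ℝ) : 0 ≤ 3 / (Real.pi * r ^ 3) * max (1 - d / r) 0 :=
  mul_nonneg (div_nonneg (by norm_num) (mul_nonneg Real.pi_pos.le (pow_nonneg hr.le 3))) (le_max_right _ _)

/-- The hard-sphere kernel `((w − v)·ω)₊` is nonnegative. [folklore] -/
theorem hsKernel_nonneg (p : EuclideanSpace ℝ (Fin 3) × EuclideanSpace ℝ (Fin 3))
    (ω : Metric.sphere (0 : EuclideanSpace ℝ (Fin 3)) 1) : 0 ≤ hardSphereKernel p ω := by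
  unfold hardSphereKernel; exact le_max_right _ _

/-- Monotonicity of the crux's collision functional in the mark, on a FINITE set of collision times (as on the flow's good set):
`0 ≤ c`, `F ≤ G` pointwise ⇒ `c·∑ᶠ_{s∈T}∑∑ 1_P F ≤ c·∑ᶠ_{s∈T}∑∑ 1_P G`.  (The decidability instance is taken from the goal.) [folklore] -/
theorem mul_finsum_ite_mono {n : ℕ} {T : Set ℝ} (hT : T.Finite) {c : ℝ} (hc : 0 ≤ c)
    {P : ℝ → Fin n → Fin n → Prop} {inst : ∀ s i j, Decidable (P s i j)}
    {F G : ℝ → Fin n → Fin n → ℝ} (hFG : ∀ s i j, F s i j ≤ G s i j) :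
    c * ∑ᶠ (s : ℝ) (_ : s ∈ T), ∑ i : Fin n, ∑ j : Fin n, (@ite ℝ (P s i j) (inst s i j) (F s i j) 0) ≤
    c * ∑ᶠ (s : ℝ) (_ : s ∈ T), ∑ i : Fin n, ∑ j : Fin n, (@ite ℝ (P s i j) (inst s i j) (G s i j) 0) := by
  refine mul_le_mul_of_nonneg_left ?_ hc
  rw [finsum_mem_eq_finite_toFinset_sum _ hT, finsum_mem_eq_finite_toFinset_sum _ hT]
  refine Finset.sum_le_sum fun s _ => Finset.sum_le_sum fun i _ => Finset.sum_le_sum fun j _ => ?_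
  split_ifs
  · exact hFG s i j
  · exact le_rfl

/-- **The union bound of the additive split, abstractly.**  Off a null set `goodᶜ`, if the cut functional `Kg ≤ K` has the floor
`g₁ s Ig − η₁` except on a set of mass `≤ a`, and the remainder `K − Kg` has the floor `g₂ s (I − Ig) − η₂` except on mass `≤ b`, then `K` has
the floor `m s I − η` (`m ≤ g₁, g₂`, `η₁ + η₂ ≤ η`, `η₂ ≥ 0`) except on mass `≤ a + b` — whatever the sign of `I − Ig` (no integrability needed:
if `I < Ig` the cut floor alone suffices). [folklore] -/
theorem measure_floor_le_of_cut_dense {α : Type*} [MeasurableSpace α] (μ : Measure α) {good : Set α}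
    (hgood : μ goodᶜ = 0) (K Kg I Ig : α → ℝ) {g₁ g₂ m s η η₁ η₂ : ℝ}
    (hm1 : m ≤ g₁) (hm2 : m ≤ g₂) (hm : 0 ≤ m) (hs : 0 ≤ s) (hη2 : 0 ≤ η₂) (hη : η₁ + η₂ ≤ η)
    (hKg : ∀ z ∈ good, Kg z ≤ K z) (hIg : ∀ z ∈ good, 0 ≤ Ig z) {a b : ℝ≥0∞}
    (h1 : μ {z | Kg z < g₁ * s * Ig z - η₁} ≤ a)
    (h2 : μ {z | K z - Kg z < g₂ * s * (I z - Ig z) - η₂} ≤ b) :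
    μ {z | K z < m * s * I z - η} ≤ a + b := by
  have hsub : {z | K z < m * s * I z - η} ⊆
      goodᶜ ∪ ({z | Kg z < g₁ * s * Ig z - η₁} ∪ {z | K z - Kg z < g₂ * s * (I z - Ig z) - η₂}) := by
    intro z hz
    by_contra hcon
    simp only [Set.mem_union, Set.mem_compl_iff, Set.mem_setOf_eq, not_or, not_not, not_lt] at hcon
    obtain ⟨hzg, hc1, hc2⟩ := hcon
    have hz' : K z < m * s * I z - η := hz
    have hk := hKg z hzg
    have hi := hIg z hzg
    have e1 : 0 ≤ (g₁ - m) * s * Ig z := mul_nonneg (mul_nonneg (sub_nonneg.2 hm1) hs) hi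
    rcases le_or_gt 0 (I z - Ig z) with hpos | hneg
    · have e2 : 0 ≤ (g₂ - m) * s * (I z - Ig z) := mul_nonneg (mul_nonneg (sub_nonneg.2 hm2) hs) hpos
      nlinarith
    · have e3 : 0 ≤ m * s * (Ig z - I z) := mul_nonneg (mul_nonneg hm hs) (by linarith)
      nlinarith
  calc μ {z | K z < m * s * I z - η}
      ≤ μ (goodᶜ ∪ ({z | Kg z < g₁ * s * Ig z - η₁} ∪ {z | K z - Kg z < g₂ * s * (I z - Ig z) - η₂})) :=
        measure_mono hsub
    _ ≤ μ goodᶜ + (μ {z | Kg z < g₁ * s * Ig z - η₁} + μ {z | K z - Kg z < g₂ * s * (I z - Ig z) - η₂}) :=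
        (measure_union_le _ _).trans (add_le_add le_rfl (measure_union_le _ _))
    _ ≤ 0 + (a + b) := by rw [hgood]; exact add_le_add le_rfl (add_le_add h1 h2)
    _ = a + b := zero_add _

/-- **The additive split by the cut (PROVED)**: `CutRateFloorKinetic → DenseRemainderKinetic → RateFloorKinetic` (lead c4's restatement (a),
`SketchSplit.RateFloorKinetic`, uncut).  With `g₁, η₀` from the cut floor, the cutoff `g*` of `exists_cutoff` (`= 1` below `η₀/2`, `= 0` above
`η₀`), the remainder stub at `η₁ := η₀/2`, `g₀ := min g₁ g₂`, `σ₀ := min`, slacks `η/2`, confidences `δ/2`, `λ₀ := max`, `N₀ := max`; pathwise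
on the flow's good set (Liouville-null complement, `measure_compl_good` + absolute continuity of the local Gibbs law): `K_N[χ g* Ξ] ≤ K_N[χ Ξ]`
(finitely many collision times in `[0,τ]`, `HardSphereFlow.finite_collisionTimes_inter`) and `∫χ g* B ≥ 0`; then
`measure_floor_le_of_cut_dense`. [folklore] -/
theorem rateFloorKinetic_of_cut_of_dense (hcut : CutRateFloorKinetic) (hden : DenseRemainderKinetic) : RateFloorKinetic := by
  obtain ⟨g₁, hg₁, η₀, hη₀, hcut⟩ := hcut
  obtain ⟨g₂, hg₂, hden⟩ := hden
  obtain ⟨gs, hgs_cont, hgs0, hgs1, hgsη₀, hgsη₁⟩ := exists_cutoff hη₀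
  refine ⟨min g₁ g₂, lt_min hg₁ hg₂, fun a₀ θ₀ u₀ ha hθ hu ha0 hθ0 => ?_⟩
  obtain ⟨σa, hσa, hcut⟩ := hcut a₀ θ₀ u₀ ha hθ hu ha0 hθ0
  obtain ⟨σb, hσb, hden⟩ := hden (η₀ / 2) (half_pos hη₀) a₀ θ₀ u₀ ha hθ hu ha0 hθ0
  refine ⟨min σa σb, lt_min hσa hσb, ?_⟩
  intro σ hσ hσlt Φ τ hτ χ hχc hχ0 Ξ hΞc hΞ0 hΞC η δ hη hδ
  have hσa' : σ < σa := hσlt.trans_le (min_le_left _ _)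
  have hσb' : σ < σb := hσlt.trans_le (min_le_right _ _)
  obtain ⟨lam₁, hlam₁, hcut⟩ := hcut σ hσ hσa' Φ τ hτ χ hχc hχ0 Ξ hΞc hΞ0 hΞC gs hgs_cont hgs0 hgs1 hgsη₁ hgsη₀
    (η / 2) (δ / 2) (by positivity) (by positivity)
  obtain ⟨lam₂, hlam₂, hden⟩ := hden σ hσ hσb' Φ τ hτ χ hχc hχ0 Ξ hΞc hΞ0 hΞC gs hgs_cont hgs0 hgs1 hgsη₁
    (η / 2) (δ / 2) (by positivity) (by positivity)
  refine ⟨max lam₁ lam₂, hlam₁.trans_le (le_max_left _ _), fun lam hlam => ?_⟩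
  obtain ⟨Na, hcut⟩ := hcut lam ((le_max_left _ _).trans hlam)
  obtain ⟨Nb, hden⟩ := hden lam ((le_max_right _ _).trans hlam)
  refine ⟨max Na Nb, fun N hN => ?_⟩
  have e1 := hcut N ((le_max_left _ _).trans hN)
  have e2 := hden N ((le_max_right _ _).trans hN)
  dsimp only at e1 e2 ⊢
  have hlam0 : 0 < lam := hlam₁.trans_le ((le_max_left _ _).trans hlam)
  have hr : 0 < lam * ((N + 1 : ℕ) : ℝ) ^ (-(1 / 3 : ℝ)) :=
    mul_pos hlam0 (Real.rpow_pos_of_pos (by positivity) _)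
  have hgood : localGibbsLaw σ a₀ u₀ θ₀ N (Φ N) (Φ N).goodᶜ = 0 := by
    rw [localGibbsLaw, particleLaw_eq]
    exact withDensity_absolutelyContinuous _ _ (Φ N).measure_compl_good
  have h := measure_floor_le_of_cut_dense (localGibbsLaw σ a₀ u₀ θ₀ N (Φ N)) hgood _ _ _ _
    (min_le_left g₁ g₂) (min_le_right g₁ g₂) (lt_min hg₁ hg₂).le (by positivity : (0 : ℝ) ≤ σ ^ 3)
    (by positivity : (0 : ℝ) ≤ η / 2) (by linarith : η / 2 + η / 2 ≤ η) ?_ ?_ e1 e2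
  · refine h.trans ?_
    rw [← ENNReal.ofReal_add (by positivity) (by positivity), add_halves]
  · -- the cut functional is below the full one, pathwise on the good set
    intro z hz
    refine mul_finsum_ite_mono ((Φ N).finite_collisionTimes_inter hz Set.Subset.rfl)
      (div_nonneg (hsDiameter_pos hσ N).le (by positivity)) ?_
    intro s i j
    exact mul_mul_le_of_le_one (hχ0 _) (hgs1 _) (hΞ0 _)
  · -- the cut ideal functional is nonnegative
    intro z _
    refine setIntegral_nonneg measurableSet_Icc fun s _ => integral_nonneg fun x => ?_
    refine mul_nonneg (mul_nonneg (hχ0 _) (hgs0 _)) (integral_nonneg fun p => ?_)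
    exact mul_nonneg (mul_nonneg (bx_nonneg hr _) (bx_nonneg hr _))
      (integral_nonneg fun ω => mul_nonneg (hΞ0 _) (hsKernel_nonneg _ _))

/-! ## §4 The crux from the registered stubs (kernel-checked composition) -/

/-- **`RateFloor_of` — THE SKELETON THEOREM**: the three registered stubs, written out verbatim, imply the crux BY NAME:
`rateFloor_of_kinetic_of_subgrid ∘ rateFloorKinetic_of_cut_of_dense ∘ cutRateFloorKinetic_of_eqSuperExpDeficitCut`. [folklore] -/
theorem RateFloor_of
    (h₁ : ∃ g₁ : ℝ, 0 < g₁ ∧ ∃ η₀ : ℝ, 0 < η₀ ∧ ∃ σ₀ : ℝ, 0 < σ₀ ∧ ∀ σ : ℝ, 0 < σ → σ < σ₀ → ∀ Φ : (N : ℕ) → Literature.Analysis.FluidPDE.HardSphereFlow (Literature.Analysis.FluidPDE.Torus.geometry (Fin 3)) (Literature.MathematicalPhysics.KineticTheory.hsDiameter σ N) (N + 1), ∀ τ : ℝ, 0 < τ → ∀ χ : ℝ × UnitAddTorus (Fin 3) → ℝ, Continuous χ → (∀ p, 0 ≤ χ p) → ∀ Ξ : EuclideanSpace ℝ (Fin 3)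 × EuclideanSpace ℝ (Fin 3) × EuclideanSpace ℝ (Fin 3) → ℝ, Continuous Ξ → (∀ q, 0 ≤ Ξ q) → (∃ C : ℝ, ∀ q, Ξ q ≤ C) → ∀ g : ℝ → ℝ, Continuous g → (∀ a, 0 ≤ g a) → (∀ a, g a ≤ 1) → (∀ a, a ≤ η₀ / 2 → g a = 1) → (∀ a, η₀ ≤ a → g a = 0) → ∀ η : ℝ, 0 < η → ∀ L : ℝ, ∃ lam₀ : ℝ, 0 < lam₀ ∧ ∀ lam : ℝ, lam₀ ≤ lam → ∃ N₀ : ℕ, ∀ N : ℕ, N₀ ≤ N → let r : ℝ := lam * ((N + 1 : ℕ) : ℝ) ^ (-(1 / 3 : ℝ)); let ε := Literature.MathematicalPhysics.KineticTheory.hsDiameter σ N; let G := Literature.Analysis.FluidPDE.Torus.geometry (Fin 3); let γ := fun z (s : ℝ) => (Φ N).flow s z; let bx : UnitAddTorus (Fin 3) → UnitAddTorus (Fin 3) → ℝ := fun x y => 3 / (Real.pi * r ^ 3) * max (1 - Literature.Analysis.FluidPDE.Torus.euclidDist x y / r) 0; let ρm := fun z s (x₀ : UnitAddTorus (Fin 3))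 => ∫ q, bx q.1 x₀ ∂(Literature.Analysis.FluidPDE.empiricalMeasure (γ z s)); let Θ := fun (Ξ : EuclideanSpace ℝ (Fin 3) × EuclideanSpace ℝ (Fin 3) × EuclideanSpace ℝ (Fin 3) → ℝ) (v w : EuclideanSpace ℝ (Fin 3)) => ∫ ω : Metric.sphere (0 : EuclideanSpace ℝ (Fin 3)) 1, Ξ ((ω : EuclideanSpace ℝ (Fin 3)), v, w) * Literature.MathematicalPhysics.KineticTheory.hardSphereKernel (w, v) ω ∂Literature.MathematicalPhysics.KineticTheory.sphereMeasure; let B := fun Ξ z s (x₀ : UnitAddTorus (Fin 3)) => ∫ p, bx p.1.1 x₀ * bx p.2.1 x₀ * Θ Ξ p.1.2 p.2.2 ∂((Literature.Analysis.FluidPDE.empiricalMeasure (γ z s)).prod (Literature.Analysis.FluidPDE.empiricalMeasure (γ z s))); let pv := fun z s (i j : Fin (N + 1)) => Literature.Analysis.FluidPDE.reflectVel (G.sepVec (γ z s i).1 (γ z s j).1) ((γ z s i).2, (γ z s j).2); let Kc := fun (Fn : Literature.Analysis.FluidPDE.Config (N + 1) (Fin 3) Literature.MathematicalPhysics.KineticTheory.T3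 → ℝ → Fin (N + 1) → Fin (N + 1) → ℝ) z => ε / (N + 1 : ℝ) * ∑ᶠ (s : ℝ) (_ : s ∈ Literature.Analysis.FluidPDE.collisionTimes G ε (γ z) ∩ Set.Icc 0 τ), ∑ i : Fin (N + 1), ∑ j : Fin (N + 1), (if i ≠ j ∧ ‖G.sepVec (γ z s i).1 (γ z s j).1‖ = ε then Fn z s i j else 0); Literature.MathematicalPhysics.KineticTheory.localGibbsLaw σ (fun _ => (1 : ℝ)) (fun _ => (0 : EuclideanSpace ℝ (Fin 3))) (fun _ => (1 : ℝ)) N (Φ N) {z | Kc (fun z s i j => χ (s, (γ z s i).1) * g (σ ^ 3 * ρm z s (γ z s i).1) * Ξ (ε⁻¹ • G.sepVec (γ z s i).1 (γ z s j).1, (pv z s i j).1, (pv z s i j).2)) z < g₁ * σ ^ 3 * (∫ s in Set.Icc (0 : ℝ) τ, ∫ x : UnitAddTorus (Fin 3), χ (s, x) * g (σ ^ 3 * ρm z s x) * B Ξ z s x) - η} ≤ ENNReal.ofReal (Real.exp (-(L * ((N : ℝ) + 1)))))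
    (h₂ : ∃ g₂ : ℝ, 0 < g₂ ∧ ∀ η₁ : ℝ, 0 < η₁ → ∀ (a₀ θ₀ : Literature.MathematicalPhysics.KineticTheory.T3 → ℝ) (u₀ : Literature.MathematicalPhysics.KineticTheory.T3 → Literature.MathematicalPhysics.KineticTheory.V3), Continuous a₀ → Continuous θ₀ → Continuous u₀ → (∀ x, 0 < a₀ x) → (∀ x, 0 < θ₀ x) → ∃ σ₀ : ℝ, 0 < σ₀ ∧ ∀ σ : ℝ, 0 < σ → σ < σ₀ → ∀ Φ : (N : ℕ) → Literature.Analysis.FluidPDE.HardSphereFlow (Literature.Analysis.FluidPDE.Torus.geometry (Fin 3)) (Literature.MathematicalPhysics.KineticTheory.hsDiameter σ N) (N + 1), ∀ τ : ℝ, 0 < τ → ∀ χ : ℝ × UnitAddTorus (Fin 3) → ℝ, Continuous χ → (∀ p, 0 ≤ χ p) → ∀ Ξ : EuclideanSpace ℝ (Fin 3) × EuclideanSpace ℝ (Fin 3) × EuclideanSpace ℝ (Fin 3) → ℝ, Continuous Ξ → (∀ q, 0 ≤ Ξ q) → (∃ C : ℝ, ∀ q, Ξ q ≤ C) → ∀ g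 : ℝ → ℝ, Continuous g → (∀ a, 0 ≤ g a) → (∀ a, g a ≤ 1) → (∀ a, a ≤ η₁ → g a = 1) → ∀ η δ : ℝ, 0 < η → 0 < δ → ∃ lam₀ : ℝ, 0 < lam₀ ∧ ∀ lam : ℝ, lam₀ ≤ lam → ∃ N₀ : ℕ, ∀ N : ℕ, N₀ ≤ N → let r : ℝ := lam * ((N + 1 : ℕ) : ℝ) ^ (-(1 / 3 : ℝ)); let ε := Literature.MathematicalPhysics.KineticTheory.hsDiameter σ N; let G := Literature.Analysis.FluidPDE.Torus.geometry (Fin 3); let γ := fun z (s : ℝ) => (Φ N).flow s z; let bx : UnitAddTorus (Fin 3) → UnitAddTorus (Fin 3) → ℝ := fun x y => 3 / (Real.pi * r ^ 3) * max (1 - Literature.Analysis.FluidPDE.Torus.euclidDist x y / r) 0; let ρm := fun z s (x₀ : UnitAddTorus (Fin 3)) => ∫ q, bx q.1 x₀ ∂(Literature.Analysis.FluidPDE.empiricalMeasure (γ z s)); let Θ := fun (Ξ : EuclideanSpace ℝ (Fin 3) × EuclideanSpace ℝ (Fin 3) × EuclideanSpace ℝ (Fin 3) → ℝ) (v w : EuclideanSpace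 ℝ (Fin 3)) => ∫ ω : Metric.sphere (0 : EuclideanSpace ℝ (Fin 3)) 1, Ξ ((ω : EuclideanSpace ℝ (Fin 3)), v, w) * Literature.MathematicalPhysics.KineticTheory.hardSphereKernel (w, v) ω ∂Literature.MathematicalPhysics.KineticTheory.sphereMeasure; let B := fun Ξ z s (x₀ : UnitAddTorus (Fin 3)) => ∫ p, bx p.1.1 x₀ * bx p.2.1 x₀ * Θ Ξ p.1.2 p.2.2 ∂((Literature.Analysis.FluidPDE.empiricalMeasure (γ z s)).prod (Literature.Analysis.FluidPDE.empiricalMeasure (γ z s))); let pv := fun z s (i j : Fin (N + 1)) => Literature.Analysis.FluidPDE.reflectVel (G.sepVec (γ z s i).1 (γ z s j).1) ((γ z s i).2, (γ z s j).2); let Kc := fun (Fn : Literature.Analysis.FluidPDE.Config (N + 1) (Fin 3) Literature.MathematicalPhysics.KineticTheory.T3 → ℝ → Fin (N + 1) → Fin (N + 1) → ℝ) z => ε / (N + 1 : ℝ) * ∑ᶠ (s : ℝ) (_ : s ∈ Literature.Analysis.FluidPDE.collisionTimes G ε (γ z) ∩ Set.Icc 0 τ), ∑ i : Fin (N + 1),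 ∑ j : Fin (N + 1), (if i ≠ j ∧ ‖G.sepVec (γ z s i).1 (γ z s j).1‖ = ε then Fn z s i j else 0); Literature.MathematicalPhysics.KineticTheory.localGibbsLaw σ a₀ u₀ θ₀ N (Φ N) {z | Kc (fun z s i j => χ (s, (γ z s i).1) * Ξ (ε⁻¹ • G.sepVec (γ z s i).1 (γ z s j).1, (pv z s i j).1, (pv z s i j).2)) z - Kc (fun z s i j => χ (s, (γ z s i).1) * g (σ ^ 3 * ρm z s (γ z s i).1) * Ξ (ε⁻¹ • G.sepVec (γ z s i).1 (γ z s j).1, (pv z s i j).1, (pv z s i j).2)) z < g₂ * σ ^ 3 * ((∫ s in Set.Icc (0 : ℝ) τ, ∫ x : UnitAddTorus (Fin 3), χ (s, x) * B Ξ z s x) - (∫ s in Set.Icc (0 : ℝ) τ, ∫ x : UnitAddTorus (Fin 3), χ (s, x) * g (σ ^ 3 * ρm z s x) * B Ξ z s x)) - η} ≤ ENNReal.ofReal δ)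
    (h₃ : ∃ Cd : ℝ, 0 < Cd ∧ ∀ (a₀ θ₀ : Literature.MathematicalPhysics.KineticTheory.T3 → ℝ) (u₀ : Literature.MathematicalPhysics.KineticTheory.T3 → Literature.MathematicalPhysics.KineticTheory.V3), Continuous a₀ → Continuous θ₀ → Continuous u₀ → (∀ x, 0 < a₀ x) → (∀ x, 0 < θ₀ x) → ∃ σ₀ : ℝ, 0 < σ₀ ∧ ∀ σ : ℝ, 0 < σ → σ < σ₀ → ∀ Φ : (N : ℕ) → Literature.Analysis.FluidPDE.HardSphereFlow (Literature.Analysis.FluidPDE.Torus.geometry (Fin 3)) (Literature.MathematicalPhysics.KineticTheory.hsDiameter σ N) (N + 1), ∀ τ : ℝ, 0 < τ → ∀ χ : ℝ × UnitAddTorus (Fin 3) → ℝ, Continuous χ → (∀ p, 0 ≤ χ p) → ∀ Ξ : EuclideanSpace ℝ (Fin 3) × EuclideanSpace ℝ (Fin 3) × EuclideanSpace ℝ (Fin 3) → ℝ, Continuous Ξ → (∀ q, 0 ≤ Ξ q) → (∃ C : ℝ, ∀ q, Ξ q ≤ C) → ∀ η δ : ℝ, 0 < η → 0 < δ → ∃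 r₀ : ℝ, 0 < r₀ ∧ ∀ r : ℝ, 0 < r → r < r₀ → ∃ lam₀ : ℝ, 0 < lam₀ ∧ ∀ lam : ℝ, lam₀ ≤ lam → ∃ N₀ : ℕ, ∀ N : ℕ, N₀ ≤ N → let γ := fun z (s : ℝ) => (Φ N).flow s z; let bx : UnitAddTorus (Fin 3) → UnitAddTorus (Fin 3) → ℝ := fun x y => 3 / (Real.pi * r ^ 3) * max (1 - Literature.Analysis.FluidPDE.Torus.euclidDist x y / r) 0; let bxk : UnitAddTorus (Fin 3) → UnitAddTorus (Fin 3) → ℝ := fun x y => 3 / (Real.pi * (lam * ((N + 1 : ℕ) : ℝ) ^ (-(1 / 3 : ℝ))) ^ 3) * max (1 - Literature.Analysis.FluidPDE.Torus.euclidDist x y / (lam * ((N + 1 : ℕ) : ℝ) ^ (-(1 / 3 : ℝ)))) 0; let Θ := fun (Ξ : EuclideanSpace ℝ (Fin 3) × EuclideanSpace ℝ (Fin 3) × EuclideanSpace ℝ (Fin 3) → ℝ) (v w : EuclideanSpace ℝ (Fin 3)) => ∫ ω : Metric.sphere (0 : EuclideanSpace ℝ (Fin 3)) 1, Ξ ((ω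 : EuclideanSpace ℝ (Fin 3)), v, w) * Literature.MathematicalPhysics.KineticTheory.hardSphereKernel (w, v) ω ∂Literature.MathematicalPhysics.KineticTheory.sphereMeasure; let B := fun Ξ z s (x₀ : UnitAddTorus (Fin 3)) => ∫ p, bx p.1.1 x₀ * bx p.2.1 x₀ * Θ Ξ p.1.2 p.2.2 ∂((Literature.Analysis.FluidPDE.empiricalMeasure (γ z s)).prod (Literature.Analysis.FluidPDE.empiricalMeasure (γ z s))); let Bk := fun Ξ z s (x₀ : UnitAddTorus (Fin 3)) => ∫ p, bxk p.1.1 x₀ * bxk p.2.1 x₀ * Θ Ξ p.1.2 p.2.2 ∂((Literature.Analysis.FluidPDE.empiricalMeasure (γ z s)).prod (Literature.Analysis.FluidPDE.empiricalMeasure (γ z s))); Literature.MathematicalPhysics.KineticTheory.localGibbsLaw σ a₀ u₀ θ₀ N (Φ N) {z | Cd * (∫ s in Set.Icc (0 : ℝ) τ, ∫ x : UnitAddTorus (Fin 3), χ (s, x) * Bk Ξ z s x) + η < (∫ s in Set.Icc (0 : ℝ) τ, ∫ x : UnitAddTorus (Fin 3), χ (s, x) * B Ξ z s x)} ≤ ENNReal.ofReal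 δ) :
    Summit.AtomisticToContinuum.HydrodynamicLimit.Theses.JParityClosure.RateFloor :=
  rateFloor_of_kinetic_of_subgrid (rateFloorKinetic_of_cut_of_dense (cutRateFloorKinetic_of_eqSuperExpDeficitCut h₁) h₂) h₃

/-- The skeleton IS the crux proof modulo the registered stubs (its only `sorry`s are S1–S3). -/
theorem RateFloor_proof : Summit.AtomisticToContinuum.HydrodynamicLimit.Theses.JParityClosure.RateFloor :=
  RateFloor_of stub_eqSuperExpDeficitCut stub_denseRemainderFloor stub_subgridDomination

end Summit.AtomisticToContinuum.HydrodynamicLimit.Cruxes.RateFloor.HydroImmuneEntropyTransfer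

end
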